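/-
Copyright: typed skeleton of published conjectural axioms; statements only (named `Prop`s with
explicit hypotheses), plus three elementary linear-algebra lemmas that Deninger states in words.
No `axiom`, no `sorry`.
-/
import Mathlib
import HarnessLib
import Literature.NumberTheory.LFunctions.ZetaZeros
import Literature.NumberTheory.LFunctions.WeilExplicit

/-!
# Deninger's conjectural arithmetic cohomology of `Spec ℤ̄` — the axioms (2.1)–(2.8), typed

Source typed VERBATIM: C. Deninger, *There is no "Weil-"cohomology theory with real coefficients
for arithmetic curves*, Ann. Sc. Norm. Super. Pisa Cl. Sci. (arXiv:2204.02714), §2, items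
(2.1)–(2.8) [cite: Deninger2022, §2 (2.1)–(2.8), arXiv p.3]; the axioms restate Deninger's
programme of 1994/1998 (his [D7] = *Motivic L-functions and regularized determinants*, Proc.
Sympos. Pure Math. 55.1 (1994) 707–743, where the `𝔽_p`-case is constructed from `l`-adic
cohomology; [D2] = ICM 1998, Doc. Math. Extra Vol. I, 163–186 — both cite-only here, acquisition
requests acq-08223 / acq-03565) and the dynamical Lefschetz-trace-formula dictionary of his [D3] =
*Number theory and dynamical systems on foliated spaces*, Jber. DMV 103 (2001) 79–100
(arXiv:math/0204110) §§2–3 [cite: Deninger2002, Thm 2.1, Conj 3.1, Thm 3.3, Cor 3.5].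

What the source says (verbatim, arXiv:2204.02714 p.3). For the arithmetic compactification
`Spec ℤ̄` (more generally `Spec 𝔬_k‾`) there should be `ℂ`-vector spaces `Hⁿ(Spec ℤ̄, 𝒞)`,
`n = 0, 1, 2`, with an endomorphism `θ` (infinitesimal generator of a "Frobenius flow") such that
* (2.1) `θ` is a derivation with respect to cup-product;
* (2.2) `H⁰ = ℂ` with `θ = 0`;
* (2.3) `H¹` is infinite dimensional, the eigenvalues of `θ` being the non-trivial zeros of `ζ`,
  "counted with their algebraic multiplicities `dim H¹^{θ∼α}`", `H^{θ∼α} = ⋃ₙ ker (θ-α)ⁿ`;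
* (2.4) a `θ`-equivariant trace isomorphism `tr : H² ⥲ ℂ(-1)`, `ℂ(-1) = ℂ` with `θ = id`;
* (2.5) hence `h₁ ∪ h₂ = θ(h₁ ∪ h₂) = θh₁ ∪ h₂ + h₁ ∪ θh₂` on `H¹ ⊗ H¹ → H² ≅ ℂ`;
* (2.6) `∪ : H¹^{θ∼α} × H¹^{θ∼1-α} → ℂ` is perfect;
* (2.7) ("much more optimistically") a canonical anti-linear `∗` on `H¹` with `∗² = -id`,
  `∗θ = θ∗`, such that `⟨h, h'⟩ := tr(h ∪ ∗h')` is a SCALAR PRODUCT; then (2.5) gives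
  (2.7′) `⟨h,h'⟩ = ⟨θh,h'⟩ + ⟨h,θh'⟩`, "hence `θ - ½` would be skew-symmetric on `H¹` and its
  eigenvalues therefore purely imaginary. Using (2.3) the Riemann hypotheses would follow. Of course
  this argument follows the lead of Serre [S]. Also note that if (2.7) is true, skew-symmetry of
  `θ - ½` would imply that the algebraic eigenspaces `H^{θ∼α}` of `θ` are the usual ones `H^{θ=α}`";
* (2.8) `ord_{s=1/2} ζ_k(s) = dim H¹^{θ∼1/2}` (a case of (2.3)).
Deninger, same paper, Thm 2.13 (arXiv p.4): "For a number field `k` there is no functorial real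
valued cohomology theory `H•(Spec 𝔬_k‾, ℛ)` with endomorphism `θ_ℝ` such that `H• ⊗_ℝ ℂ` with
`θ := θ_ℝ ⊗ id` satisfies property (2.12)" (`dim Hom_G(V_π, V_k) = ord_{s=1/2} L(V_π, s)`; proof via
a symplectic Artin representation with root number `-1`). Not typed here (it constrains
CONSTRUCTIONS of the carrier, not the implication RH ⇐ (2.3) ∧ (2.7′) below); Deninger 2023
(arXiv:2301.11643 §3, end) draws the consequence that leafwise cohomologies of foliated dynamical
systems, which always carry real structures, "are missing a fundamental twist".

What is typed here (statements only; the carrier `H` = the would-be `H¹`, `θ` its endomorphism,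
`B` the would-be scalar product `⟨h,h'⟩ = tr(h ∪ ∗h')`, linear in `h`, anti-linear in `h'`):
`zetaMultiplicity`, `SpectrumAxiom` (2.3), `CupLeibniz` (2.5 after `tr`), `CupPerfect` (2.6),
`HodgeStar` (2.7: the anti-linear `∗`), `ThetaSkew` (2.7′), `PosDef`, and the bundle
`Polarized θ B := ThetaSkew θ B ∧ PosDef B` = "the missing object" of the motivic-door autopsy
(HOME/LOCATED-GAP.md, cc-4 block). PROVED (elementary, the source's own words made formal):
`re_eq_half_of_hasEigenvector` (Serre's argument), `riemannHypothesis_of_spectrum_of_polarized`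
((2.3) ∧ (2.7′) ∧ positivity ⇒ `RiemannHypothesis`), `semisimple_of_polarized` ((2.7′) ∧ positivity
⇒ `ker (θ-ρ)² = ker (θ-ρ)`, i.e. algebraic = geometric eigenspaces).

Dictionary to the tree (docstring level, nothing new is claimed):
* "trace of `∫ g(t) e^{t(θ-1/2)} dt` on `H¹`" under (2.3) := `Σ_ρ m(ρ) ĝ(ρ)` with
  `ĝ = Literature.NumberTheory.LFunctions.weilMellin g` (`ĝ(s) = ∫ g(t) e^{(s-1/2)t} dt`); the
  dynamical Lefschetz trace formula [Deninger2002, (13), Conj 3.1, (19)] "`Σᵢ (-1)ⁱ Tr(φ* | Hⁱ)` =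
  closed-orbit terms `Σ_p log p Σ_k (…)` + fixed-point (archimedean) terms" is then, for `Spec ℤ`,
  EXACTLY the tree's PROVED `Literature.NumberTheory.LFunctions.explicit_formula`
  (`Σ_ρ m(ρ) ĝ(ρ) = weilFunctional g = ĝ(0) + ĝ(1) - weilPrimeTerm g + weilArchTerm g`;
  `H⁰` (θ = 0) and `H²` (θ = 1) carry `ĝ(0)`, `ĝ(1)`).
* Positivity: with `A_g := ∫ g(t) e^{t(θ-1/2)} dt`, (2.7′) gives `A_g† = A_{g̃}`
  (`g̃ = weilReflect g`), so `Tr(A_{g ⋆ g̃}) = Tr(A_g A_g†) ≥ 0`, i.e. `0 ≤ Re (weilQuadratic g)` =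
  the tree's `WeilPositivity` (`RiemannHypothesis ↔ WeilPositivity` PROVED: `weil_criterion_holds`).
  So in Deninger's template the needed inequality is Weil positivity itself and the missing object is
  the polarization `(∗, ⟨,⟩)`; its spectral costume "∃ θ with (2.3) and a `Polarized` form" is, by
  the lemmas below and Weil's criterion, EQUIVALENT information to RH (plus semisimplicity of θ),
  cf. the kernel-checked `Summit.RiemannHypothesis…SpectralThesis` ↔ RH and
  `Literature.Analysis.UnboundedOperators.IsHilbertPolyaOperator` (θ = ½ + iD, D self-adjoint).
* Existing carriers of (H¹, θ) WITHOUT a polarization: Meyer's `π₋`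
  (`Literature.NumberTheory.Automorphic.Meyer.spectralRealisation_rat`, PROVED `_holds`: algebraic
  multiplicity of `|x|^s` = `ord_s Λ`; there the eigenspace at a multiple zero is ONE-dimensional —
  Meyer, Duke 127 (2005) = arXiv:math/0412277, proof of Cor. 4.2 — so by `semisimple_of_polarized` a
  polarization on THAT carrier would force all zeros simple); Connes 1999 cokernel
  (`Literature.NumberTheory.ConnesConsani.Connes1999_thm_6_rat`, critical zeros only).
-/

namespace Literature.NumberTheory.Deninger2022

open Complex Module Module.End
open Literature.NumberTheory.LFunctions

variable {H : Type*} [AddCommGroup H] [Module ℂ H]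

/-! ## (2.3) The spectrum axiom -/

open scoped Classical in
/-- The multiplicity with which `α : ℂ` should occur in the spectrum of `θ` on `H¹(Spec ℤ̄, 𝒞)`:
the order of vanishing `m(α)` of `ζ` at `α` if `α` is a non-trivial zero
(`ZetaZeros.riemannZetaNontrivialZeros`, `riemannZetaZeroOrder`), and `0` otherwise.
[cite: Deninger2022, §2 (2.3), arXiv p.3] -/
noncomputable def zetaMultiplicity (α : ℂ) : ℕ :=
  if α ∈ ZetaZeros.riemannZetaNontrivialZeros then (riemannZetaZeroOrder α).toNat else 0

/-- **(2.3)** (Deninger): "`H¹(Spec 𝔬_k‾, 𝒞)` is infinite dimensional with the eigenvalues of `θ`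
being the non-trivial zeroes of `ζ_k(s)` with their multiplicities. Here the eigenvalues `α` are
counted with their algebraic multiplicities `dim H¹^{θ∼α}`", `H^{θ∼α} = {h | (θ-α)ⁿ h = 0 some n}`
= Mathlib's `Module.End.maxGenEigenspace θ α`. Typed for `k = ℚ`: every generalized eigenspace is
finite dimensional, of dimension `zetaMultiplicity α` (so `α` is an eigenvalue iff it is a
non-trivial zero; infinite-dimensionality of `H` then follows from Hardy's theorem and is not
restated). [cite: Deninger2022, §2 (2.3), arXiv p.3] -/
def SpectrumAxiom (θ : End ℂ H) : Prop :=
  ∀ α : ℂ, FiniteDimensional ℂ (θ.maxGenEigenspace α) ∧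
    Module.finrank ℂ (θ.maxGenEigenspace α) = zetaMultiplicity α

/-- The half of (2.3) that Serre's argument consumes: every non-trivial zero of `ζ` is an
eigenvalue of `θ` on `H¹`. [cite: Deninger2022, §2 (2.3), arXiv p.3] -/
def ZerosAreEigenvalues (θ : End ℂ H) : Prop :=
  ∀ ρ ∈ ZetaZeros.riemannZetaNontrivialZeros, θ.HasEigenvalue ρ

/-! ## (2.1), (2.4)–(2.6) Cup product, trace, Leibniz rule, perfectness — after composing with `tr` -/

/-- **(2.5)** = (2.1) ∧ (2.4) composed with the trace: the bilinear form
`C(h₁,h₂) := tr(h₁ ∪ h₂) : H¹ × H¹ → ℂ` satisfies `C(h₁,h₂) = C(θh₁,h₂) + C(h₁,θh₂)`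
("`θ` is a derivation, `θ = id` on `H² ≅ ℂ(-1)`"). [cite: Deninger2022, §2 (2.1) (2.4) (2.5), arXiv p.3] -/
def CupLeibniz (θ : End ℂ H) (C : H →ₗ[ℂ] H →ₗ[ℂ] ℂ) : Prop :=
  ∀ h₁ h₂ : H, C (θ h₁) h₂ + C h₁ (θ h₂) = C h₁ h₂

/-- **(2.6)**: the pairing `∪ : H¹^{θ∼α} × H¹^{θ∼1-α} → H² ≅ ℂ` is perfect (left and right
kernels trivial on the generalized eigenspaces). "In particular `α` is an eigenvalue iff `1-α` is,
with equal algebraic multiplicities" — compatible with the functional equation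
(`riemannZetaZeroOrder_one_sub`). [cite: Deninger2022, §2 (2.6), arXiv p.3] -/
def CupPerfect (θ : End ℂ H) (C : H →ₗ[ℂ] H →ₗ[ℂ] ℂ) : Prop :=
  ∀ α : ℂ,
    (∀ h₁ ∈ θ.maxGenEigenspace α, (∀ h₂ ∈ θ.maxGenEigenspace (1 - α), C h₁ h₂ = 0) → h₁ = 0) ∧
    (∀ h₂ ∈ θ.maxGenEigenspace (1 - α), (∀ h₁ ∈ θ.maxGenEigenspace α, C h₁ h₂ = 0) → h₂ = 0)

/-! ## (2.7) The polarization ("Hodge `∗`") and its consequence (2.7′) -/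

/-- **(2.7)** (the object): an anti-linear automorphism `∗` of `H¹` with `∗² = -id` and
`∗θ = θ∗`, such that `⟨h,h'⟩ := tr(h ∪ ∗h')` — here `B h h' := C h (star h')`, linear in `h`,
anti-linear in `h'` — is a scalar product (Hermitian and positive definite).
[cite: Deninger2022, §2 (2.7), arXiv p.3] -/
def HodgeStar (θ : End ℂ H) (C : H →ₗ[ℂ] H →ₗ[ℂ] ℂ) (star : H →ₗ⋆[ℂ] H)
    (B : H →ₗ[ℂ] H →ₗ⋆[ℂ] ℂ) : Prop :=
  (∀ h, star (star h) = -h) ∧ (∀ h, star (θ h) = θ (star h)) ∧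
    (∀ h h', B h h' = C h (star h')) ∧ (∀ h h', B h' h = starRingEnd ℂ (B h h')) ∧
    (∀ h, h ≠ 0 → 0 < (B h h).re)

/-- **(2.7′)** (the consequence Deninger draws from (2.5) ∧ (2.7)):
`⟨h,h'⟩ = ⟨θh,h'⟩ + ⟨h,θh'⟩`, i.e. `θ - ½` is skew with respect to `⟨,⟩`.
[cite: Deninger2022, §2 after (2.7), arXiv p.3] -/
def ThetaSkew (θ : End ℂ H) (B : H →ₗ[ℂ] H →ₗ⋆[ℂ] ℂ) : Prop :=
  ∀ h h' : H, B (θ h) h' + B h (θ h') = B h h'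

/-- Positive definiteness of the would-be scalar product `⟨h,h⟩ > 0` for `h ≠ 0`.
[cite: Deninger2022, §2 (2.7), arXiv p.3] -/
def PosDef (B : H →ₗ[ℂ] H →ₗ⋆[ℂ] ℂ) : Prop :=
  ∀ h : H, h ≠ 0 → 0 < (B h h).re

/-- THE MISSING OBJECT of the motivic-door autopsy in Deninger's template: a `θ`-compatible
positive definite sesquilinear form on a carrier `(H¹, θ)` — (2.7′) ∧ positivity. (Hermitian
symmetry is not needed for the two consequences below.) [cite: Deninger2022, §2 (2.7), arXiv p.3] -/
def Polarized (θ : End ℂ H) (B : H →ₗ[ℂ] H →ₗ⋆[ℂ] ℂ) : Prop :=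
  ThetaSkew θ B ∧ PosDef B

/-- (2.7) implies (2.7′) given (2.5): `⟨θh,h'⟩ + ⟨h,θh'⟩ = C(θh,∗h') + C(h,θ∗h') = C(h,∗h') = ⟨h,h'⟩`
using `∗θ = θ∗`. [cite: Deninger2022, §2 after (2.7), arXiv p.3] -/
theorem polarized_of_hodgeStar {θ : End ℂ H} {C : H →ₗ[ℂ] H →ₗ[ℂ] ℂ} {star : H →ₗ⋆[ℂ] H}
    {B : H →ₗ[ℂ] H →ₗ⋆[ℂ] ℂ} (hL : CupLeibniz θ C) (hS : HodgeStar θ C star B) :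
    Polarized θ B := by
  obtain ⟨-, hcomm, hBC, -, hpos⟩ := hS
  refine ⟨fun h h' => ?_, hpos⟩
  rw [hBC, hBC, hBC, hcomm]
  exact hL h (star h')

/-! ## Serre's argument: (2.3) ∧ (2.7′) ∧ positivity ⇒ RH; and (2.7′) ∧ positivity ⇒ semisimplicity -/

/-- **Serre's argument** [S = Serre, *Analogues kählériens de certaines conjectures de Weil*,
Ann. of Math. 71 (1960) 392–394], as invoked by Deninger: if `θh = ρh`, `h ≠ 0`, and
`⟨θh,h⟩ + ⟨h,θh⟩ = ⟨h,h⟩ > 0`, then `(ρ + ρ̄)⟨h,h⟩ = ⟨h,h⟩`, so `Re ρ = ½`.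
[cite: Deninger2022, §2 after (2.7), arXiv p.3] -/
theorem re_eq_half_of_hasEigenvector {θ : End ℂ H} {B : H →ₗ[ℂ] H →ₗ⋆[ℂ] ℂ}
    (hP : Polarized θ B) {ρ : ℂ} {h : H} (hh : θ.HasEigenvector ρ h) : ρ.re = 1 / 2 := by
  obtain ⟨hskew, hpos⟩ := hP
  have hθ : θ h = ρ • h := mem_eigenspace_iff.mp hh.1
  have key := hskew h h
  rw [hθ, LinearMap.map_smul, LinearMap.map_smulₛₗ, LinearMap.smul_apply] at key
  -- key : ρ • B h h + starRingEnd ℂ ρ • B h h = B h h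
  have hne : B h h ≠ 0 := by
    intro h0
    have := hpos h hh.2
    rw [h0, Complex.zero_re] at this
    exact lt_irrefl _ this
  have hsum : ρ + starRingEnd ℂ ρ = 1 := by
    have : (ρ + starRingEnd ℂ ρ) * B h h = 1 * B h h := by
      rw [add_mul, one_mul]
      simpa [smul_eq_mul] using key
    exact mul_right_cancel₀ hne this
  have hre := congr_arg Complex.re hsum
  rw [Complex.add_re, Complex.conj_re, Complex.one_re] at hre
  linarith

/-- Every eigenvalue of a polarized `θ` has real part `½`. [cite: Deninger2022, §2 after (2.7), arXiv p.3] -/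
theorem re_eq_half_of_hasEigenvalue {θ : End ℂ H} {B : H →ₗ[ℂ] H →ₗ⋆[ℂ] ℂ}
    (hP : Polarized θ B) {ρ : ℂ} (hρ : θ.HasEigenvalue ρ) : ρ.re = 1 / 2 := by
  obtain ⟨v, hv⟩ := hρ.exists_hasEigenvector
  exact re_eq_half_of_hasEigenvector hP hv

/-- From real parts on the non-trivial zero set to Mathlib's `RiemannHypothesis` (bookkeeping:
a zero that is not trivial and not `1` lies in `ZetaZeros.riemannZetaNontrivialZeros`). [folklore] -/
theorem riemannHypothesis_of_forall_re
    (hre : ∀ ρ ∈ ZetaZeros.riemannZetaNontrivialZeros, ρ.re = 1 / 2) : RiemannHypothesis := by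
  intro s hs htriv _
  refine hre s ⟨hs, ?_⟩
  rintro ⟨n, hn⟩
  exact htriv ⟨n, hn.symm⟩

/-- **"Using (2.3) the Riemann hypotheses would follow"**: a carrier `(H¹, θ)` on which every
non-trivial zero is an eigenvalue (half of (2.3)) and which carries a `θ`-compatible positive
definite form (2.7′) forces `RiemannHypothesis`. [cite: Deninger2022, §2 after (2.7), arXiv p.3] -/
theorem riemannHypothesis_of_zerosAreEigenvalues_of_polarized {θ : End ℂ H}
    {B : H →ₗ[ℂ] H →ₗ⋆[ℂ] ℂ} (h23 : ZerosAreEigenvalues θ) (hP : Polarized θ B) :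
    RiemannHypothesis :=
  riemannHypothesis_of_forall_re fun ρ hρ => re_eq_half_of_hasEigenvalue hP (h23 ρ hρ)

/-- The full spectrum axiom (2.3) contains the half used above: a non-trivial zero `ρ` has
`m(ρ) ≥ 1` (`riemannZetaZeroOrder_pos_iff`), so `dim H^{θ∼ρ} ≥ 1`, so `H^{θ∼ρ} ≠ ⊥`, and a
generalized eigenvalue is an eigenvalue (`hasUnifEigenvalue_iff_hasUnifEigenvalue_one`). [folklore] -/
theorem zerosAreEigenvalues_of_spectrumAxiom {θ : End ℂ H} (h23 : SpectrumAxiom θ) :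
    ZerosAreEigenvalues θ := by
  intro ρ hρ
  obtain ⟨hfin, hdim⟩ := h23 ρ
  have hζ : riemannZeta ρ = 0 := hρ.1
  have hρ1 : ρ ≠ 1 := by
    rintro rfl
    exact riemannZeta_one_ne_zero hζ
  have hord : 0 < riemannZetaZeroOrder ρ := (riemannZetaZeroOrder_pos_iff hρ1).mpr hζ
  have hmult : 0 < zetaMultiplicity ρ := by
    have h1 : zetaMultiplicity ρ = (riemannZetaZeroOrder ρ).toNat := by
      simp [zetaMultiplicity, hρ]
    rw [h1]
    exact Int.lt_toNat.mpr (by exact_mod_cast hord)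
  have hne : θ.maxGenEigenspace ρ ≠ ⊥ := by
    intro hbot
    have h0 : Module.finrank ℂ (θ.maxGenEigenspace ρ) = 0 := by
      rw [hbot]; simp
    omega
  have hunif : θ.HasUnifEigenvalue ρ ⊤ := hne
  exact (hasUnifEigenvalue_iff_hasUnifEigenvalue_one (by simp)).mp hunif

/-- **(2.3) ∧ (2.7′) ∧ positivity ⇒ RH** (Deninger's sentence "Using (2.3) the Riemann hypotheses
would follow", made formal). [cite: Deninger2022, §2 after (2.7), arXiv p.3] -/
theorem riemannHypothesis_of_spectrum_of_polarized {θ : End ℂ H} {B : H →ₗ[ℂ] H →ₗ⋆[ℂ] ℂ}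
    (h23 : SpectrumAxiom θ) (hP : Polarized θ B) : RiemannHypothesis :=
  riemannHypothesis_of_zerosAreEigenvalues_of_polarized (zerosAreEigenvalues_of_spectrumAxiom h23) hP

/-- **"Skew-symmetry of `θ - ½` would imply that the algebraic eigenspaces `H^{θ∼α}` are the
usual ones `H^{θ=α}`"**: if `(θ-ρ)²h = 0` then `v := (θ-ρ)h` is an eigenvector or zero; if
`v ≠ 0` then `Re ρ = ½` and `⟨v,v⟩ = ⟨θh,v⟩ - ρ⟨h,v⟩ = (1 - ρ̄ - ρ)⟨h,v⟩ = 0`, contradicting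
positivity. Hence `ker (θ-ρ)² = ker (θ-ρ)`. A consequence for existing carriers: on a realization
whose eigenspaces at multiple zeros are one-dimensional (Meyer 2005, proof of Cor. 4.2) a
polarization can exist only if all zeros of `ζ` are simple. [cite: Deninger2022, §2 after (2.7), arXiv p.3] -/
theorem semisimple_of_polarized {θ : End ℂ H} {B : H →ₗ[ℂ] H →ₗ⋆[ℂ] ℂ}
    (hP : Polarized θ B) (ρ : ℂ) (h : H)
    (h2 : θ (θ h - ρ • h) = ρ • (θ h - ρ • h)) : θ h - ρ • h = 0 := by
  by_contra hv
  have hvec : θ.HasEigenvector ρ (θ h - ρ • h) := ⟨mem_eigenspace_iff.mpr h2, hv⟩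
  have hre : ρ.re = 1 / 2 := re_eq_half_of_hasEigenvector hP hvec
  obtain ⟨hskew, hpos⟩ := hP
  -- ⟨θ h, v⟩ + ⟨h, θ v⟩ = ⟨h, v⟩ with θ v = ρ v and anti-linearity in the second slot
  have key := hskew h (θ h - ρ • h)
  rw [h2, LinearMap.map_smulₛₗ, smul_eq_mul] at key
  -- ⟨v, v⟩ = ⟨θ h, v⟩ - ρ ⟨h, v⟩ by linearity in the first slot
  have hBv : B (θ h - ρ • h) (θ h - ρ • h) =
      B (θ h) (θ h - ρ • h) - ρ * B h (θ h - ρ • h) := by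
    rw [LinearMap.map_sub₂, LinearMap.map_smul₂, smul_eq_mul]
  have hsum : ρ + starRingEnd ℂ ρ = 1 := by
    apply Complex.ext
    · rw [Complex.add_re, Complex.conj_re, Complex.one_re, hre]; norm_num
    · rw [Complex.add_im, Complex.conj_im, Complex.one_im]; ring
  have hzero : B (θ h - ρ • h) (θ h - ρ • h) = 0 := by
    rw [hBv]
    linear_combination key - (B h (θ h - ρ • h)) * hsum
  have := hpos _ hv
  rw [hzero, Complex.zero_re] at this
  exact lt_irrefl _ this

/-- Operator form of `semisimple_of_polarized`: `ker (θ - ρ)² ≤ ker (θ - ρ)`, so the generalized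
eigenspaces of a polarized `θ` are its eigenspaces. [cite: Deninger2022, §2 after (2.7), arXiv p.3] -/
theorem ker_sq_eq_ker_of_polarized {θ : End ℂ H} {B : H →ₗ[ℂ] H →ₗ⋆[ℂ] ℂ}
    (hP : Polarized θ B) (ρ : ℂ) :
    LinearMap.ker ((θ - ρ • 1) * (θ - ρ • 1)) = LinearMap.ker (θ - ρ • 1) := by
  apply le_antisymm
  · intro h hh
    rw [LinearMap.mem_ker] at hh ⊢
    have hv : (θ - ρ • 1) h = θ h - ρ • h := by simp
    have h2 : θ (θ h - ρ • h) = ρ • (θ h - ρ • h) := by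
      have : (θ - ρ • 1) ((θ - ρ • 1) h) = 0 := hh
      rw [hv, LinearMap.sub_apply, LinearMap.smul_apply, sub_eq_zero] at this
      simpa using this
    rw [hv]
    exact semisimple_of_polarized hP ρ h h2
  · intro h hh
    rw [LinearMap.mem_ker] at hh ⊢
    rw [Module.End.mul_apply, hh, map_zero]

/-! ## (2.6) ⇒ the functional-equation symmetry of the spectrum ("`α` is an eigenvalue iff `1-α` is, with equal algebraic multiplicities") -/

/-- **(2.6) ⇒ equal algebraic multiplicities at `α` and `1 - α`.** If the cup-product pairing
`H¹^{θ∼α} × H¹^{θ∼(1-α)} → ℂ` has trivial left and right kernels (2.6) and both generalized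
eigenspaces are finite dimensional (as in (2.3)), then `dim H¹^{θ∼α} = dim H¹^{θ∼(1-α)}`: each
space injects into the dual of the other. This is the linear algebra behind "Poincaré duality ⇒
functional equation" in Deninger's formalism [cite: Deninger1994, §7 (7.19)]; [cite: Deninger2022, §2 (2.6), arXiv p.3]. -/
theorem finrank_maxGenEigenspace_eq_of_cupPerfect {θ : End ℂ H} {C : H →ₗ[ℂ] H →ₗ[ℂ] ℂ}
    (hC : CupPerfect θ C) (α : ℂ)
    [FiniteDimensional ℂ (θ.maxGenEigenspace α)]
    [FiniteDimensional ℂ (θ.maxGenEigenspace (1 - α))] :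
    Module.finrank ℂ (θ.maxGenEigenspace α) =
      Module.finrank ℂ (θ.maxGenEigenspace (1 - α)) := by
  obtain ⟨hleft, hright⟩ := hC α
  -- `h₁ ↦ C(h₁, ·)|_{H^{θ∼(1-α)}}` and `h₂ ↦ C(·, h₂)|_{H^{θ∼α}}`
  let L : θ.maxGenEigenspace α →ₗ[ℂ] Module.Dual ℂ (θ.maxGenEigenspace (1 - α)) :=
    (LinearMap.lcomp ℂ ℂ (θ.maxGenEigenspace (1 - α)).subtype).comp
      (C.domRestrict (θ.maxGenEigenspace α))
  let R : θ.maxGenEigenspace (1 - α) →ₗ[ℂ] Module.Dual ℂ (θ.maxGenEigenspace α) :=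
    (LinearMap.lcomp ℂ ℂ (θ.maxGenEigenspace α).subtype).comp
      (C.flip.domRestrict (θ.maxGenEigenspace (1 - α)))
  have hLapp : ∀ (u : θ.maxGenEigenspace α) (w : θ.maxGenEigenspace (1 - α)),
      L u w = C u w := fun u w => rfl
  have hRapp : ∀ (w : θ.maxGenEigenspace (1 - α)) (u : θ.maxGenEigenspace α),
      R w u = C u w := fun w u => rfl
  have hL : Function.Injective L := by
    rw [← LinearMap.ker_eq_bot, LinearMap.ker_eq_bot']
    intro u hu
    have h0 : (u : H) = 0 := hleft u u.2 fun h₂ hh₂ => by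
      have := LinearMap.congr_fun hu ⟨h₂, hh₂⟩
      rwa [hLapp, LinearMap.zero_apply] at this
    exact Subtype.ext h0
  have hR : Function.Injective R := by
    rw [← LinearMap.ker_eq_bot, LinearMap.ker_eq_bot']
    intro w hw
    have h0 : (w : H) = 0 := hright w w.2 fun h₁ hh₁ => by
      have := LinearMap.congr_fun hw ⟨h₁, hh₁⟩
      rwa [hRapp, LinearMap.zero_apply] at this
    exact Subtype.ext h0
  have h1 := LinearMap.finrank_le_finrank_of_injective hL
  have h2 := LinearMap.finrank_le_finrank_of_injective hR
  rw [Subspace.dual_finrank_eq] at h1 h2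
  exact le_antisymm h1 h2

/-- For a finite-dimensional generalized eigenspace, `α` is an eigenvalue iff `H^{θ∼α} ≠ 0`,
i.e. iff its dimension is non-zero (private helper). [folklore] -/
private theorem hasEigenvalue_iff_finrank_maxGenEigenspace_ne_zero (θ : End ℂ H) (α : ℂ)
    [FiniteDimensional ℂ (θ.maxGenEigenspace α)] :
    θ.HasEigenvalue α ↔ Module.finrank ℂ (θ.maxGenEigenspace α) ≠ 0 := by
  rw [Ne, Submodule.finrank_eq_zero]
  constructor
  · intro hα hbot
    apply hα
    -- eigenspace ≤ maxGenEigenspace = ⊥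
    exact eq_bot_iff.mpr (le_trans (θ.eigenspace_le_maxGenEigenspace (μ := α)) hbot.le)
  · intro hne
    have hunif : θ.HasUnifEigenvalue α ⊤ := hne
    exact (hasUnifEigenvalue_iff_hasUnifEigenvalue_one (by simp)).mp hunif

/-- **(2.6) ⇒ "`α` is an eigenvalue iff `1 - α` is"** (Deninger's gloss on (2.6), for
finite-dimensional generalized eigenspaces as in (2.3)). [cite: Deninger2022, §2 (2.6), arXiv p.3] -/
theorem hasEigenvalue_iff_hasEigenvalue_one_sub_of_cupPerfect {θ : End ℂ H}
    {C : H →ₗ[ℂ] H →ₗ[ℂ] ℂ} (hC : CupPerfect θ C) (α : ℂ)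
    [FiniteDimensional ℂ (θ.maxGenEigenspace α)]
    [FiniteDimensional ℂ (θ.maxGenEigenspace (1 - α))] :
    θ.HasEigenvalue α ↔ θ.HasEigenvalue (1 - α) := by
  rw [hasEigenvalue_iff_finrank_maxGenEigenspace_ne_zero,
    hasEigenvalue_iff_finrank_maxGenEigenspace_ne_zero,
    finrank_maxGenEigenspace_eq_of_cupPerfect hC α]

/-- **(2.3) ∧ (2.6) are jointly consistent with the functional equation only**: on a carrier
satisfying the spectrum axiom (2.3), perfectness (2.6) forces `m(α) = m(1-α)` for the prescribed
multiplicities — which the tree knows independently for `ζ` (`riemannZetaZeroOrder_one_sub`); recorded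
as the formal content of "(2.6) … compatible with the functional equation".
[cite: Deninger2022, §2 (2.6), arXiv p.3] -/
theorem zetaMultiplicity_eq_one_sub_of_spectrumAxiom_of_cupPerfect {θ : End ℂ H}
    {C : H →ₗ[ℂ] H →ₗ[ℂ] ℂ} (h23 : SpectrumAxiom θ) (hC : CupPerfect θ C) (α : ℂ) :
    zetaMultiplicity α = zetaMultiplicity (1 - α) := by
  obtain ⟨hfa, hda⟩ := h23 α
  obtain ⟨hfb, hdb⟩ := h23 (1 - α)
  rw [← hda, ← hdb]
  exact finrank_maxGenEigenspace_eq_of_cupPerfect hC α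

/-! ## (2.5) ⇒ the cup product sees only the pairs `(α, 1 - α)` -/

/-- **(2.5) in shifted form**: `C((θ-α)h₁, h₂) + C(h₁, (θ-β)h₂) = (1 - α - β) · C(h₁, h₂)`; in
particular for `β = 1 - α` the operators `θ - α` and `-(θ - (1-α))` are adjoint for the cup
product. [cite: Deninger2022, §2 (2.5), arXiv p.3] -/
theorem cup_sub_smul_add_cup_sub_smul {θ : End ℂ H} {C : H →ₗ[ℂ] H →ₗ[ℂ] ℂ}
    (hL : CupLeibniz θ C) (α β : ℂ) (h₁ h₂ : H) :
    C ((θ - α • 1) h₁) h₂ + C h₁ ((θ - β • 1) h₂) = (1 - α - β) * C h₁ h₂ := by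
  have key := hL h₁ h₂
  simp only [LinearMap.sub_apply, LinearMap.smul_apply, Module.End.one_apply, map_sub, map_smul,
    smul_eq_mul]
  linear_combination key

/-- Double induction on the nilpotency orders: if `(θ-α)ⁿ h₁ = 0`, `(θ-β)ᵐ h₂ = 0` and
`α + β ≠ 1`, then `C(h₁, h₂) = 0`. (private step of the next theorem) [folklore] -/
private theorem cup_eq_zero_aux {θ : End ℂ H} {C : H →ₗ[ℂ] H →ₗ[ℂ] ℂ}
    (hL : CupLeibniz θ C) {α β : ℂ} (hαβ : α + β ≠ 1) :
    ∀ (n m : ℕ) (h₁ h₂ : H), ((θ - α • 1) ^ n) h₁ = 0 → ((θ - β • 1) ^ m) h₂ = 0 →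
      C h₁ h₂ = 0 := by
  intro n
  induction n with
  | zero =>
    intro m h₁ h₂ hn _
    rw [pow_zero, Module.End.one_apply] at hn
    rw [hn, LinearMap.map_zero₂]
  | succ n ihn =>
    intro m
    induction m with
    | zero =>
      intro h₁ h₂ _ hm
      rw [pow_zero, Module.End.one_apply] at hm
      rw [hm, map_zero]
    | succ m ihm =>
      intro h₁ h₂ hn hm
      -- peel one factor off each side
      have hn' : ((θ - α • 1) ^ n) ((θ - α • 1) h₁) = 0 := by
        rwa [pow_succ, Module.End.mul_apply] at hn
      have hm' : ((θ - β • 1) ^ m) ((θ - β • 1) h₂) = 0 := by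
        rwa [pow_succ, Module.End.mul_apply] at hm
      have h1 : C ((θ - α • 1) h₁) h₂ = 0 := ihn (m + 1) _ _ hn' hm
      have h2 : C h₁ ((θ - β • 1) h₂) = 0 := ihm h₁ _ hn hm'
      have key := cup_sub_smul_add_cup_sub_smul hL α β h₁ h₂
      rw [h1, h2, zero_add] at key
      have hc : (1 - α - β : ℂ) ≠ 0 := by
        intro h0; apply hαβ; linear_combination -h0
      exact (mul_eq_zero.mp key.symm).resolve_left hc

/-- **(2.5) ⇒ the generalized eigenspaces `H^{θ∼α}` and `H^{θ∼β}` are cup-orthogonal unless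
`α + β = 1`.** Since `θ` is a derivation for `∪` acting as the identity on `H² ≅ ℂ(-1)`, the cup
product restricted to `H^{θ∼α} × H^{θ∼β}` vanishes for `α + β ≠ 1`; so a non-degenerate (Poincaré)
duality can only pair `α` with `1 - α` — the linear algebra behind "the functional equation follows
from Poincaré duality" in Deninger's formalism [cite: Deninger1994, §7 (7.19)] and the reason (2.6)
is stated on the pairs `(α, 1-α)` [cite: Deninger2022, §2 (2.5)–(2.6), arXiv p.3]. No
finite-dimensionality is needed. -/
theorem cup_eq_zero_of_mem_maxGenEigenspace_of_add_ne_one {θ : End ℂ H}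
    {C : H →ₗ[ℂ] H →ₗ[ℂ] ℂ} (hL : CupLeibniz θ C) {α β : ℂ} (hαβ : α + β ≠ 1) {h₁ h₂ : H}
    (hh₁ : h₁ ∈ θ.maxGenEigenspace α) (hh₂ : h₂ ∈ θ.maxGenEigenspace β) : C h₁ h₂ = 0 := by
  rw [Module.End.mem_maxGenEigenspace] at hh₁ hh₂
  obtain ⟨n, hn⟩ := hh₁
  obtain ⟨m, hm⟩ := hh₂
  exact cup_eq_zero_aux hL hαβ n m h₁ h₂ hn hm

/-- In particular an eigenvector for `α` and a generalized eigenvector for `β ≠ 1 - α` are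
cup-orthogonal; e.g. `C(h, h) = 0` for every generalized eigenvector `h` with eigenvalue
`α ≠ ½` (the cup product is "alternating-like" off the critical pair).
[cite: Deninger2022, §2 (2.5)–(2.6), arXiv p.3] -/
theorem cup_self_eq_zero_of_mem_maxGenEigenspace {θ : End ℂ H} {C : H →ₗ[ℂ] H →ₗ[ℂ] ℂ}
    (hL : CupLeibniz θ C) {α : ℂ} (hα : α ≠ 1 / 2) {h : H}
    (hh : h ∈ θ.maxGenEigenspace α) : C h h = 0 :=
  cup_eq_zero_of_mem_maxGenEigenspace_of_add_ne_one hL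
    (by intro h2; apply hα; linear_combination h2 / 2) hh hh

end Literature.NumberTheory.Deninger2022
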